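import Literature.AlgebraicGeometry.Resolution.DecompletionSetup
import Mathlib.RingTheory.MvPolynomial.Ideal
import HarnessLib

/-!
# Temkin's decompletion lemma, algebraic proof — III. Exact linear control at the point

Topic: `Literature/AlgebraicGeometry/Resolution`. M. Temkin, *Inseparable local uniformization*,
J. Algebra 373 (2013) 65–119 = arXiv:0804.1554v3, Lemma 3.3.2 (tree: `Temkin2013_Lemma332_nft`).
For the chart `DecompChart` of `DecompletionSetup.lean` (`Rh = k[A][1/h]` standard étale over
`k[X₁, …, X_n]` via coordinates `Tᵢ` vanishing at the point `φh : Rh → m`) we prove the one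
piece of local information about the point that the whole algebraic proof runs on:

* `DecompChart.exists_unit_linear_control` — there is `s₀ ∈ Rh` with `φh(s₀) = 1` such that
  every `g ∈ Rh` vanishing at the point satisfies `s₀·g ∈ (T₁, …, T_n)Rh` — PROVED. This is the
  explicit content of "`k[X] → Rh` is unramified at the point, which lies over the origin" for a
  STANDARD ÉTALE algebra `Rh ≅ (k[X][W]/F)[1/G]`: writing `F(0, W) = p·q` with `p` the minimal
  polynomial of `w₀ = w(x)` over `k` (a simple root of `F(0, W)` since `F′` is a unit), Bézout
  `u p + v q = 1` in `k[W]` gives `s₀ = (vq)(w)`; if `g·G(T,w)ᴺ = Φ(T, w)` (`exists_rep`) and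
  `g(x) = 0` then `p ∣ Φ(0, W)`, whence `s₀ Φ(T, w) ≡ (v q p Ψ)(w) = (vΨ)(w)·F(0, w) ≡ 0`
  modulo `(T)` (`aeval_sub_aeval_map_mem`: `Φ(T, w) ≡ Φ(0, w)`).
* Helpers: `Tsub`, `idealT`, `w₀`, `φh_algebraMap` (`φh(b(T)) = b(0)`), `φh_aeval`,
  `exists_rep`, `algebraMap_mem_idealT` — PROVED.

It replaces, at finite level and without any analytic geometry, the use of "regular parameters"
in Temkin's proof (p. 45). All statements are [folklore]; no named facts.

## Sources

* M. Temkin, arXiv:0804.1554v3, proof of Lemma 3.3.2 (pp. 45–46).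
* The Stacks Project, Tag 00UE (structure of standard étale algebras), through Mathlib.
-/

noncomputable section

open Polynomial

namespace Literature.AlgebraicGeometry.Resolution

universe u

variable {k K m : Type u} [Field k] [Field K] [Algebra k K] [Field m] [Algebra k m]

/-! ### Exact linear control at the point (the explicit content of unramifiedness) -/

open scoped Polynomial.Bivariate

namespace DecompChart

variable {V : ValuationSubring k} {O : ValuationSubring m} {A : Subring K}
  {φ : Algebra.adjoin k (A : Set K) →ₐ[k] m} (C : DecompChart V O A φ)

/-- The coordinates as elements of `Rh`. [folklore] -/
def Tsub (i : Fin C.n) : C.Rh := ⟨C.T i, C.hTRh i⟩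

/-- `Tsub i` is `Tᵢ`. [folklore] -/
@[simp] theorem coe_Tsub (i : Fin C.n) : (C.Tsub i : K) = C.T i := rfl

/-- `Xᵢ ↦ Tsub i`. [folklore] -/
theorem algebraMap_X' (i : Fin C.n) :
    algebraMap (MvPolynomial (Fin C.n) k) C.Rh (MvPolynomial.X i) = C.Tsub i := C.algebraMap_X i

/-- The coordinates vanish at the point. [folklore] -/
@[simp] theorem φh_Tsub (i : Fin C.n) : C.φh (C.Tsub i) = 0 := C.hφT i

/-- The ideal `(T₁, …, T_n) ⊆ Rh` of the fibre of the chart over the origin. [folklore] -/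
def idealT : Ideal C.Rh := Ideal.span (Set.range C.Tsub)

/-- `Tᵢ ∈ (T)`. [folklore] -/
theorem Tsub_mem_idealT (i : Fin C.n) : C.Tsub i ∈ C.idealT := Ideal.subset_span ⟨i, rfl⟩

/-- The value `w₀ = w(x) ∈ m` at the point of the generator `w = P.x` of the standard étale
presentation `Rh ≅ (k[X][W]/F)[1/G]`. [folklore] -/
def w₀ : m := C.φh C.P.x

/-- `G(T, w)` is a unit of `Rh`. [folklore] -/
theorem isUnit_aeval_g : IsUnit (Polynomial.aeval C.P.x C.P.g) := C.P.hasMap.2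

/-- `F(T, w) = 0`. [folklore] -/
theorem aeval_x_f : Polynomial.aeval C.P.x C.P.f = 0 := C.P.hasMap.1

/-- The point on the coordinate ring: `φh(b(T)) = b(0)`. [folklore] -/
theorem φh_algebraMap (b : MvPolynomial (Fin C.n) k) :
    C.φh (algebraMap (MvPolynomial (Fin C.n) k) C.Rh b) =
      algebraMap k m (MvPolynomial.constantCoeff b) := by
  have h1 : C.φh.comp (MvPolynomial.aeval (R := k) C.Tsub) =
      MvPolynomial.aeval (R := k) (fun _ => (0 : m)) := by
    rw [MvPolynomial.comp_aeval]
    congr 1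
    funext i
    exact C.φh_Tsub i
  change C.φh (MvPolynomial.aeval (R := k) C.Tsub b) = _
  rw [← AlgHom.comp_apply, h1, MvPolynomial.aeval_zero']

/-- The point on `k[X]`-polynomial expressions in `w`: `φh(Φ(T, w)) = Φ(0, w₀)`. [folklore] -/
theorem φh_aeval (Φ : (MvPolynomial (Fin C.n) k)[X]) :
    C.φh (Polynomial.aeval C.P.x Φ) = Polynomial.aeval C.w₀
      (Φ.map (MvPolynomial.constantCoeff : MvPolynomial (Fin C.n) k →+* k)) := by
  rw [Polynomial.aeval_def, ← AlgHom.coe_toRingHom, Polynomial.hom_eval₂, Polynomial.aeval_def,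
    Polynomial.eval₂_map]
  congr 1
  ext b
  · simp [C.φh_algebraMap (MvPolynomial.C b)]
  · simp [C.φh_algebraMap (MvPolynomial.X b)]

/-- **Representation** of elements of `Rh` through the standard étale presentation: every
`z ∈ Rh` satisfies `z·G(T,w)ᴺ = Φ(T, w)` for a polynomial `Φ ∈ k[X][W]`. [folklore] -/
theorem exists_rep (z : C.Rh) : ∃ (Φ : (MvPolynomial (Fin C.n) k)[X]) (N : ℕ),
    z * (Polynomial.aeval C.P.x C.P.g) ^ N = Polynomial.aeval C.P.x Φ := by
  suffices H : ∀ Ξ : (MvPolynomial (Fin C.n) k)[X][Y], ∃ (Φ : (MvPolynomial (Fin C.n) k)[X])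
      (N : ℕ), Polynomial.aevalAeval C.P.x (↑(C.P.hasMap.2.unit⁻¹)) Ξ *
        (Polynomial.aeval C.P.x C.P.g) ^ N = Polynomial.aeval C.P.x Φ by
    obtain ⟨ξ, rfl⟩ := C.P.lift_bijective.surjective z
    obtain ⟨Ξ, rfl⟩ := Ideal.Quotient.mk_surjective ξ
    exact H Ξ
  intro Ξ
  induction Ξ using Polynomial.induction_on' with
  | add p q hp hq =>
    obtain ⟨Φ₁, N₁, h₁⟩ := hp
    obtain ⟨Φ₂, N₂, h₂⟩ := hq
    refine ⟨Φ₁ * C.P.g ^ N₂ + Φ₂ * C.P.g ^ N₁, N₁ + N₂, ?_⟩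
    rw [map_add, add_mul, map_add, map_mul, map_mul, map_pow, map_pow, ← h₁, ← h₂, pow_add]
    ring
  | monomial j Φ =>
    refine ⟨Φ, j, ?_⟩
    have hu : (↑(C.P.hasMap.2.unit⁻¹) : C.Rh) * Polynomial.aeval C.P.x C.P.g = 1 :=
      C.P.hasMap.2.val_inv_mul
    rw [← Polynomial.C_mul_X_pow_eq_monomial, map_mul, map_pow, Polynomial.aevalAeval_C,
      Polynomial.aevalAeval_Y, mul_assoc, ← mul_pow, hu, one_pow, mul_one]

/-- Base polynomials without constant term evaluate into `(T)`. [folklore] -/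
theorem algebraMap_mem_idealT {b : MvPolynomial (Fin C.n) k}
    (hb : MvPolynomial.constantCoeff b = 0) :
    algebraMap (MvPolynomial (Fin C.n) k) C.Rh b ∈ C.idealT := by
  classical
  -- `b ∈ (X₁, …, X_n)`
  have hbX : b ∈ Ideal.span (MvPolynomial.X '' (Set.univ : Set (Fin C.n)) :
      Set (MvPolynomial (Fin C.n) k)) := by
    rw [MvPolynomial.mem_ideal_span_X_image]
    intro mono hmono
    have hmono0 : mono ≠ 0 := by
      rintro rfl
      rw [MvPolynomial.mem_support_iff, ← MvPolynomial.constantCoeff_eq, hb] at hmono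
      exact hmono rfl
    obtain ⟨i, hi⟩ := Finsupp.ne_iff.mp hmono0
    exact ⟨i, Set.mem_univ _, hi⟩
  have hmap := Ideal.mem_map_of_mem (algebraMap (MvPolynomial (Fin C.n) k) C.Rh) hbX
  rw [Ideal.map_span] at hmap
  refine (Ideal.span_le.mpr ?_) hmap
  rintro _ ⟨_, ⟨i, -, rfl⟩, rfl⟩
  rw [SetLike.mem_coe, C.algebraMap_X']
  exact C.Tsub_mem_idealT i

/-- `Φ(T, w) ≡ Φ(0, w) (mod (T))` for `Φ ∈ k[X][W]`. [folklore] -/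
theorem aeval_sub_aeval_map_mem (Φ : (MvPolynomial (Fin C.n) k)[X]) :
    Polynomial.aeval C.P.x Φ - Polynomial.aeval C.P.x
      (Φ.map (MvPolynomial.constantCoeff : MvPolynomial (Fin C.n) k →+* k)) ∈ C.idealT := by
  rw [← Polynomial.aeval_map_algebraMap (MvPolynomial (Fin C.n) k) C.P.x
    (Φ.map (MvPolynomial.constantCoeff : MvPolynomial (Fin C.n) k →+* k)), ← map_sub,
    Polynomial.aeval_eq_sum_range]
  refine Ideal.sum_mem _ fun j _ => ?_
  rw [Algebra.smul_def]
  refine Ideal.mul_mem_right _ _ (C.algebraMap_mem_idealT ?_)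
  rw [Polynomial.coeff_sub, Polynomial.coeff_map, Polynomial.coeff_map, map_sub,
    MvPolynomial.algebraMap_eq, MvPolynomial.constantCoeff_C, sub_self]

/-- **Exact linear control at the point.** There is `s₀ ∈ Rh` with `φh(s₀) = 1` such that every
`g ∈ Rh` vanishing at the point satisfies `s₀·g ∈ (T₁, …, T_n)`. This is the explicit content
of "`k[X] → Rh` is unramified at `x` with `x` lying over the origin" for a STANDARD ÉTALE
algebra: with `F₀ = F(0, W) = p·q`, `p` the minimal polynomial of `w₀ = w(x)` (a simple root of
`F₀`, `F′` being a unit), Bézout `u p + v q = 1` gives `s₀ = (vq)(w)`; and if `g·Gᴺ = Φ(T, w)`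
with `Φ(0, w₀) = 0` then `p ∣ Φ(0, W)`, so `s₀ Φ(T,w) ≡ (vqpΨ)(w) = (vΨ)(w)·F₀(w) ≡ 0`
modulo `(T)`. [folklore] -/
theorem exists_unit_linear_control :
    ∃ s₀ : C.Rh, C.φh s₀ = 1 ∧ ∀ g : C.Rh, C.φh g = 0 → s₀ * g ∈ C.idealT := by
  classical
  haveI := C.hfin
  have hF₀w₀ : Polynomial.aeval C.w₀ (C.P.f.map
      (MvPolynomial.constantCoeff : MvPolynomial (Fin C.n) k →+* k)) = 0 := by
    rw [← C.φh_aeval, C.aeval_x_f, map_zero]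
  have hF₀' : Polynomial.aeval C.w₀ (derivative (C.P.f.map
      (MvPolynomial.constantCoeff : MvPolynomial (Fin C.n) k →+* k))) ≠ 0 := by
    rw [Polynomial.derivative_map, ← C.φh_aeval]
    exact ((C.P.hasMap.isUnit_derivative_f).map C.φh).ne_zero
  have hw₀int : IsIntegral k C.w₀ := IsIntegral.of_finite k C.w₀
  have hpa : Polynomial.aeval C.w₀ (minpoly k C.w₀) = 0 := minpoly.aeval k _
  obtain ⟨q, hq⟩ := minpoly.dvd k C.w₀ hF₀w₀
  -- `w₀` is a simple root of `F₀ = p q`, so `p ∤ q`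
  have hpq : ¬ minpoly k C.w₀ ∣ q := by
    rintro ⟨r, hr⟩
    apply hF₀'
    rw [hq, hr]
    simp only [derivative_mul, map_add, map_mul, hpa, zero_mul, mul_zero, add_zero]
  have hirr : Irreducible (minpoly k C.w₀) := minpoly.irreducible hw₀int
  have hcop : IsCoprime (minpoly k C.w₀) q := (Irreducible.coprime_iff_not_dvd hirr).mpr hpq
  obtain ⟨u, v, huv⟩ := hcop
  refine ⟨Polynomial.aeval C.P.x (v * q), ?_, ?_⟩
  · -- `φh(s₀) = v(w₀) q(w₀) = 1 - u(w₀) p(w₀) = 1`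
    rw [← Polynomial.aeval_algHom_apply]
    change Polynomial.aeval C.w₀ (v * q) = 1
    have := congrArg (Polynomial.aeval C.w₀) huv
    rw [map_add, map_mul, map_mul, hpa, mul_zero, zero_add, map_one] at this
    rw [map_mul]
    exact this
  · intro g hg
    obtain ⟨Φ, N, hrep⟩ := C.exists_rep g
    have hΦ₀ : Polynomial.aeval C.w₀
        (Φ.map (MvPolynomial.constantCoeff : MvPolynomial (Fin C.n) k →+* k)) = 0 := by
      rw [← C.φh_aeval, ← hrep, map_mul, hg, zero_mul]
    obtain ⟨Ψ, hΨ⟩ := minpoly.dvd k C.w₀ hΦ₀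
    have key : Polynomial.aeval C.P.x (v * q) * Polynomial.aeval C.P.x Φ ∈ C.idealT := by
      have h1 := C.aeval_sub_aeval_map_mem Φ
      have h2 := C.aeval_sub_aeval_map_mem C.P.f
      rw [C.aeval_x_f, zero_sub, Ideal.neg_mem_iff] at h2
      have h3 : Polynomial.aeval C.P.x (v * q) * Polynomial.aeval C.P.x
            (Φ.map (MvPolynomial.constantCoeff : MvPolynomial (Fin C.n) k →+* k)) =
          Polynomial.aeval C.P.x (v * Ψ) * Polynomial.aeval C.P.x
            (C.P.f.map (MvPolynomial.constantCoeff : MvPolynomial (Fin C.n) k →+* k)) := by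
        rw [hΨ, hq, ← map_mul, ← map_mul]
        congr 1
        ring
      have h4 : Polynomial.aeval C.P.x (v * q) * Polynomial.aeval C.P.x Φ =
          Polynomial.aeval C.P.x (v * q) * (Polynomial.aeval C.P.x Φ - Polynomial.aeval C.P.x
            (Φ.map (MvPolynomial.constantCoeff : MvPolynomial (Fin C.n) k →+* k))) +
          Polynomial.aeval C.P.x (v * Ψ) * Polynomial.aeval C.P.x
            (C.P.f.map (MvPolynomial.constantCoeff : MvPolynomial (Fin C.n) k →+* k)) := by
        rw [mul_sub, h3]; ring
      rw [h4]
      exact Ideal.add_mem _ (Ideal.mul_mem_left _ _ h1) (Ideal.mul_mem_left _ _ h2)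
    have hunit := (C.isUnit_aeval_g).pow N
    have h5 : Polynomial.aeval C.P.x (v * q) * g =
        (Polynomial.aeval C.P.x (v * q) * Polynomial.aeval C.P.x Φ) * ↑(hunit.unit⁻¹) := by
      rw [← hrep, mul_assoc, mul_assoc, IsUnit.mul_val_inv, mul_one]
    rw [h5]
    exact Ideal.mul_mem_right _ _ key

end DecompChart

end Literature.AlgebraicGeometry.Resolution
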